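import Mathlib
import Summits.NavierStokesRegularity.NavierStokesRegularity.Theorems.TaoLadderRungTwoBreakOneShiftFrameRowsSelf
import Summits.NavierStokesRegularity.NavierStokesRegularity.Theorems.TaoLadderRungTwoBreakOneShiftFrameRates
import Summits.NavierStokesRegularity.NavierStokesRegularity.Theorems.TaoLadderRungTwoBreakOneShiftFrameEnvelopes
import HarnessLib

/-!
# The one-shift Banach argument on a GEOMETRIC FRAME: the three infinite row families reduced to finitely many rows

`exists_surviving_dssWave_of_windowCert_v4` (…OneShiftWindowReduction) concludes a non-trivial surviving
discretely-self-similar wave of the shell model from a window certificate plus three row families indexed by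
ALL tail shells `k ∈ ℤ`: the rate rows `hRrow` (time-Lipschitz constants of the image tails), the contraction
rows `hrow` and the self-map rows `hrows`.  On a geometric frame — metric weights, amplitude envelopes, tube
radii and centre deviations geometric in the wake (`k ≤ -1`) and above the window (`k ≥ W`) — every one of
these families follows from its FIRST row (`wake_rows_of_first`, `top_rows_of_first`, `wake_selfRows_of_first`,
`top_selfRows_of_first`) once the rate function is taken to be the explicit four-shift bilinear bound
(`rateExpr_wake_le`, `rateExpr_top_le`).  `exists_surviving_dssWave_of_windowCert_v5` is that assembly: its
hypothesis list is the window certificate, the window-side Lipschitz numbers in edge form (as in `v4`), the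
frame envelopes (equalities / one-sided geometric bounds — definitional for a concrete frame), the two
boundary contraction rows `k = -1`, `k = W`, the wake-entry self-map row, and four first rows.  No row family
over all `k ∈ ℤ` remains.  Model lattice only (Tao-type averaged cascade); nothing here is about Navier–Stokes.
[cite: Tao2016AveragedNS, §4 Lemma 4.1, §5.3–§6; cell vocabulary, harvest/h2-tao-ladder
rung1/KERNEL-STAGE3-PLAN.md §6 (brick 9), rung1/STAGE3-BANACH.md]
-/

noncomputable section

namespace Summit.NavierStokesRegularity.NavierStokesRegularity.Theorems

namespace DSSOneShift

open Set MeasureTheory intervalIntegral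
open Literature.Analysis.FluidPDE Literature.Analysis.FluidPDE.TaoCascade CertificateGlueOn

variable {m : ℕ}

namespace OneShiftFrame

variable (F : OneShiftFrame m)

/-- A tail shell (one outside the window `0 … W-1`) is the wake entry `-1`, a deep wake shell `-n-2`, the
first shell above the window `W`, or a higher shell `W+n+1`. [folklore] -/
theorem tail_index_cases {k : ℤ} (hk : ¬ F.InWindow k) :
    k = -1 ∨ (∃ n : ℕ, k = -(n : ℤ) - 2) ∨ k = (F.W : ℤ) ∨ ∃ n : ℕ, k = (F.W : ℤ) + n + 1 := by
  unfold InWindow at hk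
  by_cases h1 : k = -1
  · exact Or.inl h1
  by_cases h2 : k ≤ -2
  · exact Or.inr (Or.inl ⟨(-k - 2).toNat, by omega⟩)
  by_cases h3 : k = (F.W : ℤ)
  · exact Or.inr (Or.inr (Or.inl h3))
  · exact Or.inr (Or.inr (Or.inr ⟨(k - (F.W : ℤ) - 1).toNat, by omega⟩))

/-- Two consecutive tail shells `k, k+1` (window of width `≥ 1`) are either both in the deep wake
(`k = -j-2`) or both above the window (`k = W+j`). [folklore] -/
theorem tail_index_cases₂ (hW1 : 1 ≤ F.W) {k : ℤ} (hk : ¬ F.InWindow k) (hk1 : ¬ F.InWindow (k + 1)) :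
    (∃ j : ℕ, k = -(j : ℤ) - 2) ∨ ∃ j : ℕ, k = (F.W : ℤ) + j := by
  unfold InWindow at hk hk1
  by_cases h2 : k ≤ -2
  · exact Or.inl ⟨(-k - 2).toNat, by omega⟩
  · exact Or.inr ⟨(k - (F.W : ℤ)).toNat, by omega⟩

/-- **The one-shift Banach argument on a geometric frame (assembly, brick 9).**  The conclusion of
`exists_surviving_dssWave_of_windowCert_v4` — a non-trivial surviving discretely-self-similar wave
`IsDSSWave ε₀ α (Equiv.refl Unit) T Φ ∧ Surviving 1 ε₀ T ∧ Φ ≢ 0` — from: the window certificate `cert`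
and the window-side Lipschitz numbers in edge form (`hWedge, hγedge, hZedge, hDedge, hqX, hwinIn`, exactly as
in `v4`); the rate function FIXED to the four-shift bilinear bound (`hRdef`); a geometric frame in the wake
(`hwtW : wt(-j-1) = ω θ^{j+1}`, `hAW : A(-j) ≤ ā β^j`, `hrec` for the tube radii, `hdevW` for the centre
deviations) and above the window (`hwtT, hAT, htubeT, hdevT`) with the rate constraints
`1 ≤ β ≤ θ, β ≤ Λ, β²/Λ ≤ ξ, δ ≤ ξ, 0 < ϑ ≤ 1, ϑ_A ≤ ϑ, Λ ϑ_A ≤ 1, ϑ_A ≤ ϑ_R`; and FINITELY MANY rows: the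
boundary contraction rows `hrowB` (`k = -1`) and `hrowT` (`k = W`), the wake-entry self-map row `hrow1`, and the
four first rows `hfirstW` (contraction, `k = -2`), `hfirstT` (contraction, `k = W+1`), `hfirstWS` (self-map,
`k = -2`), `hfirstTS` (self-map, `k = W`).  The infinite families `hRrow`, `hrow`, `hrows` of `v4` are derived
(`rateExpr_wake_le`, `rateExpr_top_le`, `wake_rows_of_first`, `top_rows_of_first`, `wake_selfRows_of_first`,
`top_selfRows_of_first`).  Conditional glue for the Tao-type shell model only; nothing about Navier–Stokes.
[cite: Tao2016AveragedNS, §4 Lemma 4.1 (4.8), §5.3–§6; cell vocabulary, harvest/h2-tao-ladder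
rung1/KERNEL-STAGE3-PLAN.md §6, rung1/STAGE3-BANACH.md §1–§2, rung1/INSTANCE-SHEET-T4-0.1-W76.md] -/
theorem exists_surviving_dssWave_of_windowCert_v5 {ε₀ Mα Q β C₀ ϱ q gHi A1 : ℝ}
    {Z Sb Se γx γb γe dz0 χb χe : ℝ}
    {ω θ abar κ ξ dbar δ ωt ϑ abart ϑA ϑR εR : ℝ}
    {α : Fin m → Fin m → Fin m → ℤ × ℤ × ℤ → ℝ} (cert : OneShiftWindowCert F ε₀ α)
    (R A devC vmax χbm χem : ℤ → ℝ)
    (hε : 0 < 1 + ε₀) (hΛ1 : 1 ≤ bigLam ε₀) (hMα : 0 ≤ Mα) (hα : ∀ i₁ i₂ i₃ μ, |α i₁ i₂ i₃ μ| ≤ Mα)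
    (hW1 : 1 ≤ F.W) (hq : 0 ≤ q) (hq1 : q < 1) (hA0 : ∀ k, 0 ≤ A k)
    (hAtail : ∀ j k', ¬ F.InWindow k' → |F.tubeC j k'| + F.tubeR k' ≤ A k')
    (hAwin : ∀ w, F.Adm w → ∀ j k', F.InWindow k' → ∀ s ∈ Icc 0 F.τhi, |F.fullFamily cert w j k' s| ≤ A k')
    -- the rate function IS the four-shift bilinear bound
    (hRdef : ∀ k : ℤ, R k = (m : ℝ) ^ 2 * Mα * ((1 + ε₀) ^ ((5 : ℝ) * k / 2) * (A k * A k + 2 * (A k * A (k + 1))) +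
        (1 + ε₀) ^ ((5 : ℝ) * ((k : ℝ) - 1) / 2) * (A (k - 1) * A (k - 1))))
    (hg0 : ∀ w, F.Adm w → 0 ≤ gfac (slice (F.fullFamily cert w) (F.decodeTau w)) ∧
      gfac (slice (F.fullFamily cert w) (F.decodeTau w)) ≤ gHi)
    -- window side, EDGE FORM (the engine's STAGE3 lines)
    (hWedge : ∀ u v, F.AdmLip R u → F.AdmLip R v → ∀ B E : ℝ,
      (∀ i, ∀ t ∈ Icc 0 F.τhi, |F.decodeTail u i (-1) t - F.decodeTail v i (-1) t| ≤ B) →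
      (∀ i, ∀ t ∈ Icc 0 F.τhi, |F.decodeTail u i F.W t - F.decodeTail v i F.W t| ≤ E) →
        dist (F.rawWindow cert u) (F.rawWindow cert v) ≤ Z * dist u v + Sb * B + Se * E)
    (hγedge : ∀ u v, F.AdmLip R u → F.AdmLip R v → ∀ B E : ℝ,
      (∀ i, ∀ t ∈ Icc 0 F.τhi, |F.decodeTail u i (-1) t - F.decodeTail v i (-1) t| ≤ B) →
      (∀ i, ∀ t ∈ Icc 0 F.τhi, |F.decodeTail u i F.W t - F.decodeTail v i F.W t| ≤ E) →
        |gfac (slice (F.fullFamily cert u) (F.decodeTau u)) -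
          gfac (slice (F.fullFamily cert v) (F.decodeTau v))| ≤ γx * dist u v + γb * B + γe * E)
    (hZedge : ∀ u v, F.AdmLip R u → F.AdmLip R v → ∀ i, ∀ B E : ℝ,
      (∀ i, ∀ t ∈ Icc 0 F.τhi, |F.decodeTail u i (-1) t - F.decodeTail v i (-1) t| ≤ B) →
      (∀ i, ∀ t ∈ Icc 0 F.τhi, |F.decodeTail u i F.W t - F.decodeTail v i F.W t| ≤ E) →
        |F.fullFamily cert u i 0 (F.decodeTau u) - F.fullFamily cert v i 0 (F.decodeTau v)| ≤
          dz0 * dist u v + χb * B + χe * E)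
    (hDedge : ∀ u v, F.AdmLip R u → F.AdmLip R v → ∀ j k', F.InWindow k' → ∀ s ∈ Icc 0 F.τhi, ∀ B E : ℝ,
      (∀ i, ∀ t ∈ Icc 0 F.τhi, |F.decodeTail u i (-1) t - F.decodeTail v i (-1) t| ≤ B) →
      (∀ i, ∀ t ∈ Icc 0 F.τhi, |F.decodeTail u i F.W t - F.decodeTail v i F.W t| ≤ E) →
        |F.fullFamily cert u j k' s - F.fullFamily cert v j k' s| ≤ vmax k' * dist u v + χbm k' * B + χem k' * E)
    (hqX : Z + Sb * F.wt (-1) + Se * F.wt F.W ≤ q)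
    (hDwin0 : ∀ k', F.InWindow k' → 0 ≤ vmax k' + χbm k' * F.wt (-1) + χem k' * F.wt F.W)
    (hγ0 : 0 ≤ γx + γb * F.wt (-1) + γe * F.wt F.W)
    -- geometric frame: wake side
    (hθ : 1 ≤ θ) (hβ1 : 1 ≤ β) (hβθ : β ≤ θ) (hβΛ : β ≤ bigLam ε₀) (hω : 0 ≤ ω) (habar : 0 ≤ abar)
    (hwtW : ∀ j : ℕ, F.wt (-(j : ℤ) - 1) = ω * θ ^ (j + 1))
    (hAW : ∀ j : ℕ, A (-(j : ℤ)) ≤ abar * β ^ j)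
    (hξ : 0 ≤ ξ) (hδ : 0 ≤ δ) (hδξ : δ ≤ ξ) (hσξ : β ^ 2 * (bigLam ε₀)⁻¹ ≤ ξ) (hdbar : 0 ≤ dbar)
    (hrec : ∀ j : ℕ, gHi * F.tubeR (-(j : ℤ) - 1) + κ * ξ ^ (j + 2) ≤ F.tubeR (-(j : ℤ) - 2))
    (hdevW : ∀ j : ℕ, devC (-(j : ℤ) - 2) ≤ dbar * δ ^ (j + 2))
    -- geometric frame: above the window
    (hϑ0 : 0 < ϑ) (hϑ1 : ϑ ≤ 1) (hϑA0 : 0 < ϑA) (hϑAϑ : ϑA ≤ ϑ) (hΛϑA : bigLam ε₀ * ϑA ≤ 1)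
    (hωt : 0 ≤ ωt) (habart : 0 ≤ abart)
    (hwtT : ∀ j : ℕ, F.wt ((F.W : ℤ) + j) = ωt * ϑ ^ j)
    (hAT : ∀ j : ℕ, A ((F.W : ℤ) - 1 + j) ≤ abart * ϑA ^ j)
    (hϑR : 0 < ϑR) (hϑAR : ϑA ≤ ϑR)
    (htubeT : ∀ j : ℕ, F.tubeR ((F.W : ℤ) + j) = εR * ϑR ^ j)
    (hdevT : ∀ j : ℕ, devC ((F.W : ℤ) + j) ≤ 0)
    -- the finitely many rows
    (hfirstW : ∀ i, gHi * (ω * θ + (4 * (m : ℝ) ^ 2 * Mα * abar ^ 2 * β ^ 2) * (β ^ 2 * (bigLam ε₀)⁻¹) * F.rτ) +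
      abar * β * (γx + γb * F.wt (-1) + γe * F.wt F.W) +
      F.τhi * (2 * tableAbsSum α i * (bigLam ε₀)⁻¹ ^ 2 * (ω * θ ^ 3) * (abar * β ^ 3)) ≤ q * (ω * θ ^ 2))
    (hfirstWS : dbar * δ ^ 2 +
      F.τhi * ((4 * (m : ℝ) ^ 2 * Mα * abar ^ 2 * β ^ 2) * (β ^ 2 * (bigLam ε₀)⁻¹) ^ 2) ≤ κ * ξ ^ 2)
    (hfirstT : ∀ i, gHi * (ωt * ϑ ^ 2 +
        (4 * (m : ℝ) ^ 2 * Mα * abart ^ 2 * bigLam ε₀ ^ F.W) * (bigLam ε₀ * ϑA ^ 2) ^ 2 * F.rτ) +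
      (abart * ϑA) * ϑA ^ 2 * (γx + γb * F.wt (-1) + γe * F.wt F.W) +
      F.τhi * (2 * tableAbsSum α i * bigLam ε₀ ^ (F.W + 1) * ωt * (abart * ϑA)) ≤ q * (ωt * ϑ))
    (hfirstTS : gHi * (εR * ϑR) + F.τhi * (4 * (m : ℝ) ^ 2 * Mα * abart ^ 2 * bigLam ε₀ ^ F.W) ≤ εR)
    (hrowB : ∀ i, gHi * (dz0 + χb * F.wt (-1) + χe * F.wt F.W) + A 0 * (γx + γb * F.wt (-1) + γe * F.wt F.W) +
      F.τhi * quadTermLip ε₀ α A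
        (fun k' => if F.InWindow k' then vmax k' + χbm k' * F.wt (-1) + χem k' * F.wt F.W else F.wt k') i (-1) ≤
        q * F.wt (-1))
    (hrowT : ∀ i, gHi * (F.wt ((F.W : ℤ) + 1) + R ((F.W : ℤ) + 1) * F.rτ) +
      A ((F.W : ℤ) + 1) * (γx + γb * F.wt (-1) + γe * F.wt F.W) +
      F.τhi * quadTermLip ε₀ α A
        (fun k' => if F.InWindow k' then vmax k' + χbm k' * F.wt (-1) + χem k' * F.wt F.W else F.wt k') i F.W ≤
        q * F.wt F.W)
    (hrow1 : A1 + F.τhi * R (-1) ≤ F.tubeR (-1))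
    -- the rest as in `v4`
    (h0 : ∃ u, F.AdmLip R u)
    (hwinIn : ∀ u, F.AdmLip R u →
      (∀ i k, |(F.rawWindow cert u).1 i k| ≤ 1) ∧ |(F.rawWindow cert u).2| ≤ 1)
    (hdev : ∀ w, F.Adm w → ∀ i k, ¬ F.InWindow k → ¬ F.InWindow (k + 1) →
      |gfac (slice (F.fullFamily cert w) (F.decodeTau w)) * F.tubeC i (k + 1) - F.tubeC i k| ≤ devC k)
    (hA1 : ∀ w, F.Adm w → ∀ i,
      |gfac (slice (F.fullFamily cert w) (F.decodeTau w)) * F.fullFamily cert w i 0 (F.decodeTau w) -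
        F.tubeC i (-1)| ≤ A1)
    (hg : ∀ u, F.AdmLip R u →
      1 < gfac (slice (F.fullFamily cert u) (F.decodeTau u)) ^ 2 ∧
        gfac (slice (F.fullFamily cert u) (F.decodeTau u)) ^ 2 ≤ 1 + ε₀ ∧
        gfac (slice (F.fullFamily cert u) (F.decodeTau u)) < bigLam ε₀ ∧
        β ^ 2 < gfac (slice (F.fullFamily cert u) (F.decodeTau u)) * bigLam ε₀)
    (hQA : A 0 ≤ Q)
    (hwakeTube : ∀ i (n : ℕ), 1 ≤ n → |F.tubeC i (-(n : ℤ))| + F.tubeR (-(n : ℤ)) ≤ Q * β ^ n)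
    (hϱ : 0 < ϱ) (hϱ1 : ϱ * bigLam ε₀ < 1) (hC₀ : 0 ≤ C₀)
    (htopTube : ∀ i (j : ℕ), |F.tubeC i ((F.W : ℤ) + j)| + F.tubeR ((F.W : ℤ) + j) ≤ C₀ * ϱ ^ (F.W + j))
    (hne : ∃ i, F.a i 0 < |F.yc i 0|) :
    ∃ (T : ℝ) (Φ : Unit → ℝ → Em m), 0 < T ∧ IsDSSWave ε₀ α (Equiv.refl Unit) T Φ ∧ Surviving 1 ε₀ T ∧
      ∃ x, Φ () x ≠ 0 := by
  -- positivity of the frame constants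
  have hΛpos : 0 < bigLam ε₀ := lt_of_lt_of_le one_pos hΛ1
  have hgHi : 0 ≤ gHi := by
    obtain ⟨u₀, hu₀⟩ := h0
    exact (hg0 u₀ hu₀.1).1.trans (hg0 u₀ hu₀.1).2
  have hσ0 : 0 ≤ β ^ 2 * (bigLam ε₀)⁻¹ := by positivity
  have hσθ : β ^ 2 * (bigLam ε₀)⁻¹ ≤ θ := by
    have hβΛ' : β * (bigLam ε₀)⁻¹ ≤ 1 := by
      rw [mul_inv_le_iff₀ hΛpos, one_mul]; exact hβΛ
    calc β ^ 2 * (bigLam ε₀)⁻¹ = β * (β * (bigLam ε₀)⁻¹) := by ring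
      _ ≤ β * 1 := mul_le_mul_of_nonneg_left hβΛ' (by linarith)
      _ = β := mul_one β
      _ ≤ θ := hβθ
  have hrbar0 : 0 ≤ 4 * (m : ℝ) ^ 2 * Mα * abar ^ 2 * β ^ 2 := by positivity
  have hσt0 : 0 ≤ bigLam ε₀ * ϑA ^ 2 := by positivity
  have hσtA : bigLam ε₀ * ϑA ^ 2 ≤ ϑA := by
    calc bigLam ε₀ * ϑA ^ 2 = bigLam ε₀ * ϑA * ϑA := by ring
      _ ≤ 1 * ϑA := mul_le_mul_of_nonneg_right hΛϑA hϑA0.le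
      _ = ϑA := one_mul ϑA
  have hrbart0 : 0 ≤ 4 * (m : ℝ) ^ 2 * Mα * abart ^ 2 * bigLam ε₀ ^ F.W := by positivity
  -- the combined Lipschitz-weight function `D` of `v4`
  have hDnn : ∀ k', 0 ≤ (fun k' => if F.InWindow k' then vmax k' + χbm k' * F.wt (-1) + χem k' * F.wt F.W
      else F.wt k') k' := by
    intro k'
    by_cases hk' : F.InWindow k'
    · simp only [if_pos hk']; exact hDwin0 k' hk'
    · simp only [if_neg hk']; exact (F.wt_pos k').le
  have hDW : ∀ j : ℕ, (fun k' => if F.InWindow k' then vmax k' + χbm k' * F.wt (-1) + χem k' * F.wt F.W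
      else F.wt k') (-(j : ℤ) - 1) ≤ ω * θ ^ (j + 1) := by
    intro j
    have hk' : ¬ F.InWindow (-(j : ℤ) - 1) := by unfold InWindow; omega
    simp only [if_neg hk', hwtW j, le_refl]
  have hDT : ∀ j : ℕ, (fun k' => if F.InWindow k' then vmax k' + χbm k' * F.wt (-1) + χem k' * F.wt F.W
      else F.wt k') ((F.W : ℤ) + j) ≤ ωt * ϑ ^ j := by
    intro j
    have hk' : ¬ F.InWindow ((F.W : ℤ) + j) := by unfold InWindow; omega
    simp only [if_neg hk', hwtT j, le_refl]
  -- the rate envelopes from the four-shift bilinear bound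
  have hRW : ∀ j : ℕ, R (-(j : ℤ) - 1) ≤
      (4 * (m : ℝ) ^ 2 * Mα * abar ^ 2 * β ^ 2) * (β ^ 2 * (bigLam ε₀)⁻¹) ^ (j + 1) := by
    intro j
    rw [hRdef]
    refine (rateExpr_wake_le (m := m) hε hΛ1 hMα hβ1 habar hA0 hAW j).trans_eq ?_
    ring
  have hRW2 : ∀ j : ℕ, R (-(j : ℤ) - 2) ≤
      (4 * (m : ℝ) ^ 2 * Mα * abar ^ 2 * β ^ 2) * (β ^ 2 * (bigLam ε₀)⁻¹) ^ (j + 2) := by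
    intro j
    have h := hRW (j + 1)
    have e : (-((j + 1 : ℕ) : ℤ) - 1) = -(j : ℤ) - 2 := by push_cast; ring
    rw [e] at h
    exact h
  have hAT' : ∀ j : ℕ, A ((F.W : ℤ) + j) ≤ abart * ϑA * ϑA ^ j := by
    intro j
    have h := hAT (j + 1)
    have e : (F.W : ℤ) - 1 + ((j + 1 : ℕ) : ℤ) = (F.W : ℤ) + j := by push_cast; ring
    rw [e] at h
    calc A ((F.W : ℤ) + j) ≤ abart * ϑA ^ (j + 1) := h
      _ = abart * ϑA * ϑA ^ j := by ring
  have hRT : ∀ j : ℕ, R ((F.W : ℤ) + j) ≤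
      (4 * (m : ℝ) ^ 2 * Mα * abart ^ 2 * bigLam ε₀ ^ F.W) * (bigLam ε₀ * ϑA ^ 2) ^ j := by
    intro j
    rw [hRdef]
    refine (rateExpr_top_le (m := m) F.W hε hΛ1 hMα hϑA0 (hϑAϑ.trans hϑ1) habart hA0 hAT j).trans_eq ?_
    rw [pow_add, mul_pow, pow_mul]
    ring
  refine F.exists_surviving_dssWave_of_windowCert_v4 cert R A devC vmax χbm χem hε hMα hα hW1 hq hq1 hA0
    hAtail hAwin (fun k => (hRdef k).symm.le) hg0 hWedge hγedge hZedge hDedge hqX ?_ h0 hwinIn hdev hA1 ?_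
    hrow1 hg hQA hβ1 hwakeTube hϱ hϱ1 hC₀ htopTube hne
  · -- contraction rows: boundary rows given, interior rows from the first ones
    intro i k hk
    rcases F.tail_index_cases hk with rfl | ⟨n, rfl⟩ | rfl | ⟨n, rfl⟩
    · have h0w : F.InWindow (-1 + 1) := by unfold InWindow; omega
      rw [if_pos h0w]
      have e : (-1 : ℤ) + 1 = 0 := by norm_num
      simp only [e]
      exact hrowB i
    · have hnw : ¬ F.InWindow (-(n : ℤ) - 2 + 1) := by unfold InWindow; omega
      rw [if_neg hnw]
      exact F.wake_rows_of_first hε hΛ1 hθ hβ1 hβθ hβΛ hσ0 hσθ hω habar hrbar0 hgHi hγ0 α hA0 hDnn hDW hAW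
        hRW hwtW hfirstW i n
    · have hnw : ¬ F.InWindow ((F.W : ℤ) + 1) := by unfold InWindow; omega
      rw [if_neg hnw]
      exact hrowT i
    · have hnw : ¬ F.InWindow ((F.W : ℤ) + n + 1 + 1) := by unfold InWindow; omega
      rw [if_neg hnw]
      exact F.top_rows_of_first hε hΛ1 hϑ0 hϑ1 (by positivity) hϑAϑ hσt0 (hσtA.trans hϑAϑ) hΛϑA hωt
        (by positivity) hrbart0 hgHi hγ0 α hA0 hDnn hDT hAT' hRT hwtT hfirstT i n
  · -- self-map rows from the first ones
    intro k hk hk1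
    rcases F.tail_index_cases₂ hW1 hk hk1 with ⟨j, rfl⟩ | ⟨j, rfl⟩
    · exact F.wake_selfRows_of_first hξ hδ hδξ hσ0 hσξ hdbar hrbar0 hrec hdevW hRW2 hfirstWS j
    · exact F.top_selfRows_of_first hϑR hσt0 (hσtA.trans hϑAR) hrbart0 htubeT hdevT hRT hfirstTS j

end OneShiftFrame

end DSSOneShift

end Summit.NavierStokesRegularity.NavierStokesRegularity.Theorems
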